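import Summits.Ventures.CertifiedArithmetic.LowPrec.SRSaturationCoupling
import Summits.Ventures.CertifiedArithmetic.LowPrec.SRExtension
import Summits.Ventures.CertifiedArithmetic.LowPrec.SRTreeHoeffding
import HarnessLib

/-!
# Stochastic rounding into a finite format, XII: the saturation probability is exponentially small

HONEST FRAMING: certified error envelopes and provably optimal rounding/accumulation schemes for
low-precision formats under stated cost models; every table by two implementations; no hardware or
vendor claims.

The analytic half of the removal of the no-saturation hypothesis (files X, X′, XI). For a format
`F'` that does NOT saturate along the tree `T` (the refinement of file X′), with candidate gap `≤ G`
on every branch, and DATA with headroom `h` — every internal node's exact partial sum lies in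
`[lo + h, hi − h]`, the window `[lo, hi]` lying in the hull of `H` —, the expected number of nodes
whose pre-rounding value leaves the hull of `H` satisfies

  `satProb F' H T ≤ satBoundT G h T = ∑_{internal v, m_v ≥ 1} 2·exp(−2h² / (m_v G²))`,

`m_v` = number of roundings strictly below `v` (`nodeBound`; a node with two leaf children cannot
exit). Proof: at node `v = (l, r)` the pre-rounding value is `ŝ_l + ŝ_r`, a sum of two INDEPENDENT
centred sub-Gaussian variables (tree mgf bound of file VII, `treeExp_exp_le`, parameters `m_l G²/4`,
`m_r G²/4`); an exit forces `|ŝ_l + ŝ_r − s_v| ≥ h`; Chernoff. Crude form (`satBoundT_le`):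
`satBoundT ≤ 2(m − 1)·exp(−2h²/((m − 1)G²))`, `m = T.nodes`.

Combined with file X (`satProbT F T = exitProb ≤ satProb`) this bounds the saturation probability
of SR summation in `F` itself; the every-format statements are in `SRSaturationFormats`.
Scope (honest): the bound is useful when `h/G ≳ √(m log m)`; binary16-class accumulators
(`maxRat/G = 2047`) have such headroom for thousands of terms, FP8 accumulators (`maxRat/G = 14`
for E4M3) essentially never do — there saturation is NOT a rare event and only the exact finite
certificates apply.
-/

namespace Summit.Ventures.CertifiedArithmetic.LowPrec.SR

open Literature.ComputerArithmetic.ConnollyHighamMary2021 Finset Real STree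

/-! ### The bound: shape-only -/

/-- Per-node bound `2·exp(−2h²/(m G²))` for a node with `m ≥ 1` roundings below it; `0` for `m = 0`
(two leaf children: the pre-rounding value is the exact partial sum, which has headroom). -/
noncomputable def nodeBound (G h : ℝ) (m : ℕ) : ℝ :=
  if m = 0 then 0 else 2 * exp (-2 * h ^ 2 / (m * G ^ 2))

/-- `satBoundT G h T = ∑_{internal nodes v} nodeBound G h m_v` (depends on the SHAPE of `T` only). -/
noncomputable def satBoundT {L : Type*} (G h : ℝ) : STree L → ℝ
  | .leaf _ => 0
  | .node l r => satBoundT G h l + satBoundT G h r + nodeBound G h (l.nodes + r.nodes)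

/-- The per-node bound is nonnegative. -/
theorem nodeBound_nonneg (G h : ℝ) (m : ℕ) : 0 ≤ nodeBound G h m := by
  unfold nodeBound; split_ifs <;> positivity

/-- The bound is nonnegative. -/
theorem satBoundT_nonneg {L : Type*} (G h : ℝ) : ∀ T : STree L, 0 ≤ satBoundT G h T
  | .leaf _ => le_rfl
  | .node l r => add_nonneg (add_nonneg (satBoundT_nonneg G h l) (satBoundT_nonneg G h r))
      (nodeBound_nonneg G h _)

/-- The bound is invariant under relabelling the leaves (cast `ℚ → ℝ`). -/
theorem satBoundT_map {L M : Type*} (φ : L → M) (G h : ℝ) : ∀ T : STree L,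
    satBoundT G h (T.map φ) = satBoundT G h T
  | .leaf _ => rfl
  | .node l r => by
      simp only [STree.map, satBoundT, satBoundT_map φ G h l, satBoundT_map φ G h r, nodes_map]

/-! ### One node: the sum of two independent sub-Gaussian subtree values -/

/-- The pair mgf: `E_l E_r e^{θ(ŝ_l + ŝ_r − s_v)} ≤ e^{m_l θ²G²/8} · e^{m_r θ²G²/8}` (independence of the
two subtrees = iterated expectation; tree mgf bound on each). -/
theorem pair_exp_le (F : Finset ℝ) (G θ : ℝ) (l r : STree ℝ) (hl : NoSatT F l) (hr : NoSatT F r)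
    (hgl : GapLET F G l) (hgr : GapLET F G r) :
    treeExp F l (fun a => treeExp F r (fun b => exp (θ * (a + b - (l.exact + r.exact)))))
      ≤ exp (l.nodes * (θ ^ 2 * G ^ 2 / 8)) * exp (r.nodes * (θ ^ 2 * G ^ 2 / 8)) := by
  have ihl := treeExp_exp_le F G θ l hl hgl
  have ihr := treeExp_exp_le F G θ r hr hgr
  set Br := exp ((r.nodes : ℝ) * (θ ^ 2 * G ^ 2 / 8)) with hBr
  have hB : ∀ a, treeExp F r (fun b => exp (θ * (a + b - (l.exact + r.exact))))
      = exp (θ * (a - l.exact)) * treeExp F r (fun b => exp (θ * (b - r.exact))) := by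
    intro a
    rw [← treeExp_mul_left]
    refine treeExp_congr F r (fun b => ?_)
    rw [← exp_add]; congr 1; ring
  rw [treeExp_congr F l hB]
  calc treeExp F l (fun a => exp (θ * (a - l.exact)) * treeExp F r (fun b => exp (θ * (b - r.exact))))
      ≤ treeExp F l (fun a => Br * exp (θ * (a - l.exact))) :=
        treeExp_mono F l (fun a => by
          rw [mul_comm]; exact mul_le_mul_of_nonneg_right ihr (exp_pos _).le)
    _ = Br * treeExp F l (fun a => exp (θ * (a - l.exact))) := treeExp_mul_left F l _ _
    _ ≤ Br * exp (l.nodes * (θ ^ 2 * G ^ 2 / 8)) := mul_le_mul_of_nonneg_left ihl (exp_pos _).le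
    _ = exp (l.nodes * (θ ^ 2 * G ^ 2 / 8)) * Br := mul_comm _ _

/-- An exit from `[lo, hi] ⊆ hull H` at a node with headroom `h` is a deviation `≥ h` of the
pre-rounding value from the exact partial sum: `outInd ≤ 𝟙{dev ≥ h, up} + 𝟙{dev ≥ h, down}`. -/
theorem outInd_le_devInds (H : Finset ℝ) {lo hi h s : ℝ} (hH : ∀ c, lo ≤ c → c ≤ hi → InHull H c)
    (h1 : lo + h ≤ s) (h2 : s ≤ hi - h) (v : ℝ) :
    outInd H v ≤ upDevInd h s v + dnDevInd h s v := by
  unfold outInd upDevInd dnDevInd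
  by_cases hin : InHull H v
  · rw [if_pos hin]; split_ifs <;> norm_num
  · rw [if_neg hin]
    have hout : v < lo ∨ hi < v := by
      by_contra hc
      push Not at hc
      exact hin (hH v hc.1 hc.2)
    rcases hout with hv | hv
    · have : h ≤ s - v := by linarith
      rw [if_pos this]; split_ifs <;> norm_num
    · have : h ≤ v - s := by linarith
      rw [if_pos this]; split_ifs <;> norm_num

/-- A tree without roundings is a leaf: its value is its exact sum, surely. -/
theorem treeExp_of_nodes_eq_zero (F : Finset ℝ) : ∀ (T : STree ℝ) (f : ℝ → ℝ), T.nodes = 0 →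
    treeExp F T f = f T.exact
  | .leaf _, _, _ => rfl
  | .node _ _, _, h => by simp [STree.nodes] at h

/-- **One node.** Under no saturation and gap `≤ G` in both subtrees and headroom `h > 0` at the node,
`P(ŝ_l + ŝ_r ∉ hull H) ≤ nodeBound G h (m_l + m_r)`. -/
theorem node_outProb_le (F H : Finset ℝ) (G : ℝ) {lo hi h : ℝ} (hh : 0 < h)
    (hH : ∀ c, lo ≤ c → c ≤ hi → InHull H c) (l r : STree ℝ) (hl : NoSatT F l) (hr : NoSatT F r)
    (hgl : GapLET F G l) (hgr : GapLET F G r) (h1 : lo + h ≤ l.exact + r.exact)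
    (h2 : l.exact + r.exact ≤ hi - h) :
    treeExp F l (fun a => treeExp F r (fun b => outInd H (a + b))) ≤ nodeBound G h (l.nodes + r.nodes) := by
  set s := l.exact + r.exact with hs
  unfold nodeBound
  split_ifs with hm
  · -- two leaf children: the pre-rounding value IS `s`, which lies in the window
    have hl0 : l.nodes = 0 := by omega
    have hr0 : r.nodes = 0 := by omega
    rw [treeExp_of_nodes_eq_zero F l _ hl0, treeExp_of_nodes_eq_zero F r _ hr0]
    unfold outInd
    rw [if_pos (hH _ (by linarith) (by linarith))]
  -- pointwise Chernoff, then the pair mgf with `±θ`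
  have hpt : ∀ a b, outInd H (a + b) ≤ upDevInd h s (a + b) + dnDevInd h s (a + b) :=
    fun a b => outInd_le_devInds H hH h1 h2 (a + b)
  have hsplit : treeExp F l (fun a => treeExp F r (fun b => outInd H (a + b)))
      ≤ treeExp F l (fun a => treeExp F r (fun b => upDevInd h s (a + b)))
        + treeExp F l (fun a => treeExp F r (fun b => dnDevInd h s (a + b))) := by
    rw [← treeExp_add]
    refine treeExp_mono F l (fun a => ?_)
    rw [← treeExp_add]
    exact treeExp_mono F r (fun b => hpt a b)
  have hone : ∀ θ : ℝ, 0 ≤ θ →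
      treeExp F l (fun a => treeExp F r (fun b => upDevInd h s (a + b)))
        ≤ exp (-(θ * h)) * (exp (l.nodes * (θ ^ 2 * G ^ 2 / 8)) * exp (r.nodes * (θ ^ 2 * G ^ 2 / 8))) ∧
      treeExp F l (fun a => treeExp F r (fun b => dnDevInd h s (a + b)))
        ≤ exp (-(θ * h)) * (exp (l.nodes * (θ ^ 2 * G ^ 2 / 8)) * exp (r.nodes * (θ ^ 2 * G ^ 2 / 8))) := by
    intro θ hθ
    constructor
    · calc treeExp F l (fun a => treeExp F r (fun b => upDevInd h s (a + b)))
          ≤ treeExp F l (fun a => treeExp F r (fun b =>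
              exp (-(θ * h)) * exp (θ * (a + b - (l.exact + r.exact))))) :=
            treeExp_mono F l (fun a => treeExp_mono F r (fun b => upDevInd_le_exp h s (a + b) hθ))
        _ = exp (-(θ * h)) * treeExp F l (fun a => treeExp F r (fun b =>
              exp (θ * (a + b - (l.exact + r.exact))))) := by
            rw [← treeExp_mul_left]
            exact treeExp_congr F l (fun a => treeExp_mul_left F r _ _)
        _ ≤ _ := mul_le_mul_of_nonneg_left (pair_exp_le F G θ l r hl hr hgl hgr) (exp_pos _).le
    · calc treeExp F l (fun a => treeExp F r (fun b => dnDevInd h s (a + b)))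
          ≤ treeExp F l (fun a => treeExp F r (fun b =>
              exp (-(θ * h)) * exp ((-θ) * (a + b - (l.exact + r.exact))))) :=
            treeExp_mono F l (fun a => treeExp_mono F r (fun b => dnDevInd_le_exp h s (a + b) hθ))
        _ = exp (-(θ * h)) * treeExp F l (fun a => treeExp F r (fun b =>
              exp ((-θ) * (a + b - (l.exact + r.exact))))) := by
            rw [← treeExp_mul_left]
            exact treeExp_congr F l (fun a => treeExp_mul_left F r _ _)
        _ ≤ _ := by
            refine mul_le_mul_of_nonneg_left ?_ (exp_pos _).le
            have := pair_exp_le F G (-θ) l r hl hr hgl hgr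
            rwa [neg_sq] at this
  by_cases hD : ((l.nodes + r.nodes : ℕ) : ℝ) * G ^ 2 = 0
  · -- degenerate exponent (`G = 0`): the bound is `2`
    have h0 := hone 0 le_rfl
    simp only [zero_mul, neg_zero, exp_zero, one_mul, ne_eq, zero_pow, OfNat.ofNat_ne_zero,
      not_false_eq_true, zero_div, mul_zero] at h0
    rw [hD, div_zero, exp_zero, mul_one]
    linarith [h0.1, h0.2]
  · have hpos : 0 < ((l.nodes + r.nodes : ℕ) : ℝ) * G ^ 2 := lt_of_le_of_ne (by positivity) (Ne.symm hD)
    set θ := 4 * h / (((l.nodes + r.nodes : ℕ) : ℝ) * G ^ 2) with hθ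
    have hθ0 : 0 ≤ θ := by positivity
    have hmain := hone θ hθ0
    have key : exp (-(θ * h)) * (exp (l.nodes * (θ ^ 2 * G ^ 2 / 8)) * exp (r.nodes * (θ ^ 2 * G ^ 2 / 8)))
        = exp (-2 * h ^ 2 / (((l.nodes + r.nodes : ℕ) : ℝ) * G ^ 2)) := by
      rw [← exp_add, ← exp_add]; congr 1
      rw [hθ]; push_cast; field_simp; push_cast at hpos ⊢; ring
    rw [key] at hmain
    linarith [hmain.1, hmain.2]

/-! ### The tree: summing the node bounds -/

/-- **SATURATION PROBABILITY, EXPONENTIAL FORM.** If `F'` does not saturate along `T`, has candidate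
gap `≤ G` on every branch, the data has headroom `h > 0` in `[lo, hi]`, and `[lo, hi] ⊆ hull H`, then
the expected number of exits from the hull of `H` is at most `satBoundT G h T`. With file X
(`satProbT H T ≤ satProb F' H T` for `Agrees H F'`): `P(SR summation of T in H saturates) ≤ satBoundT`. -/
theorem satProb_le_satBoundT (F H : Finset ℝ) (G : ℝ) {lo hi h : ℝ} (hh : 0 < h)
    (hH : ∀ c, lo ≤ c → c ≤ hi → InHull H c) :
    ∀ T : STree ℝ, NoSatT F T → GapLET F G T → HeadroomT lo hi h T → satProb F H T ≤ satBoundT G h T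
  | .leaf _, _, _, _ => le_rfl
  | .node l r, ⟨hl, hr, _⟩, ⟨hgl, hgr, _⟩, ⟨hHl, hHr, h1, h2⟩ => by
      simp only [satProb, satBoundT]
      exact add_le_add (add_le_add (satProb_le_satBoundT F H G hh hH l hl hgl hHl)
        (satProb_le_satBoundT F H G hh hH r hr hgr hHr))
        (node_outProb_le F H G hh hH l r hl hr hgl hgr h1 h2)

/-! ### Crude closed form `2(m − 1)·exp(−2h²/((m − 1)G²))` -/

/-- Number of internal nodes with at least one rounding below them (the non-zero terms). -/
def cnt {L : Type*} : STree L → ℕ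
  | .leaf _ => 0
  | .node l r => cnt l + cnt r + min 1 (l.nodes + r.nodes)

/-- `cnt ≤ nodes`. -/
theorem cnt_le_nodes {L : Type*} : ∀ T : STree L, cnt T ≤ T.nodes
  | .leaf _ => le_rfl
  | .node l r => by
      simp only [cnt, STree.nodes]
      have := cnt_le_nodes l; have := cnt_le_nodes r
      omega

/-- `cnt ≤ nodes − 1`: some internal node has two leaf children. -/
theorem cnt_le_nodes_sub_one {L : Type*} : ∀ T : STree L, cnt T ≤ T.nodes - 1
  | .leaf _ => le_rfl
  | .node l r => by
      simp only [cnt, STree.nodes]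
      have hl := cnt_le_nodes_sub_one l; have hr := cnt_le_nodes_sub_one r
      have hl' := cnt_le_nodes l; have hr' := cnt_le_nodes r
      omega

/-- Uniform node bound: with `0 < G`, every term is at most `2·exp(−2h²/(M G²))` once `m_v ≤ M`. -/
theorem nodeBound_le {G : ℝ} (hG : 0 < G) (h : ℝ) {m M : ℕ} (hmM : m ≤ M) :
    nodeBound G h m ≤ ((min 1 m : ℕ) : ℝ) * (2 * exp (-2 * h ^ 2 / (M * G ^ 2))) := by
  unfold nodeBound
  split_ifs with hm
  · simp [hm]
  · rw [show min 1 m = 1 by omega, Nat.cast_one, one_mul]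
    have hm' : 0 < (m : ℝ) := by exact_mod_cast Nat.pos_of_ne_zero hm
    have hM' : (m : ℝ) ≤ M := by exact_mod_cast hmM
    refine mul_le_mul_of_nonneg_left (exp_le_exp.mpr ?_) (by norm_num)
    rw [neg_mul, neg_div, neg_div, neg_le_neg_iff]
    exact div_le_div_of_nonneg_left (by positivity) (by positivity)
      (mul_le_mul_of_nonneg_right hM' (sq_nonneg G))

/-- `satBoundT ≤ cnt · 2exp(−2h²/(M G²))` whenever `T.nodes ≤ M + 1`. -/
theorem satBoundT_le_cnt {L : Type*} {G : ℝ} (hG : 0 < G) (h : ℝ) (M : ℕ) :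
    ∀ T : STree L, T.nodes ≤ M + 1 →
      satBoundT G h T ≤ cnt T * (2 * exp (-2 * h ^ 2 / (M * G ^ 2)))
  | .leaf _, _ => by simp [satBoundT, cnt]
  | .node l r, hT => by
      simp only [STree.nodes] at hT
      have ihl := satBoundT_le_cnt hG h M l (by omega)
      have ihr := satBoundT_le_cnt hG h M r (by omega)
      have hn := nodeBound_le hG h (m := l.nodes + r.nodes) (M := M) (by omega)
      simp only [satBoundT, cnt]
      calc satBoundT G h l + satBoundT G h r + nodeBound G h (l.nodes + r.nodes)
          ≤ (cnt l : ℝ) * (2 * exp (-2 * h ^ 2 / (M * G ^ 2)))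
            + (cnt r : ℝ) * (2 * exp (-2 * h ^ 2 / (M * G ^ 2)))
            + ((min 1 (l.nodes + r.nodes) : ℕ) : ℝ) * (2 * exp (-2 * h ^ 2 / (M * G ^ 2))) :=
            add_le_add (add_le_add ihl ihr) hn
        _ = ((cnt l + cnt r + min 1 (l.nodes + r.nodes) : ℕ) : ℝ)
            * (2 * exp (-2 * h ^ 2 / (M * G ^ 2))) := by push_cast; ring

/-- **Crude closed form**: `satBoundT G h T ≤ 2(m − 1)·exp(−2h²/((m − 1)G²))`, `m = T.nodes`
(natural-number subtraction: `0` for `m ≤ 1`). -/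
theorem satBoundT_le {L : Type*} {G : ℝ} (hG : 0 < G) (h : ℝ) (T : STree L) :
    satBoundT G h T
      ≤ 2 * ((T.nodes - 1 : ℕ) : ℝ) * exp (-2 * h ^ 2 / (((T.nodes - 1 : ℕ) : ℝ) * G ^ 2)) := by
  have h1 := satBoundT_le_cnt hG h (T.nodes - 1) T (by omega)
  have h2 : (cnt T : ℝ) ≤ ((T.nodes - 1 : ℕ) : ℝ) := by exact_mod_cast cnt_le_nodes_sub_one T
  have h3 : 0 < 2 * exp (-2 * h ^ 2 / (((T.nodes - 1 : ℕ) : ℝ) * G ^ 2)) := by positivity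
  nlinarith

/-! ### Casts -/

/-- `HeadroomT` commutes with the cast `ℚ → ℝ`. -/
theorem headroomT_cast (lo hi h : ℚ) : ∀ T : STree ℚ,
    HeadroomT (lo : ℝ) hi h (T.map ((↑) : ℚ → ℝ)) ↔ HeadroomT lo hi h T
  | .leaf _ => Iff.rfl
  | .node l r => by
      simp only [STree.map, HeadroomT, headroomT_cast lo hi h l, headroomT_cast lo hi h r,
        exact_map_cast]
      refine and_congr_right' (and_congr_right' ?_)
      rw [← Rat.cast_add, ← Rat.cast_add, ← Rat.cast_sub, Rat.cast_le, Rat.cast_le]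

end Summit.Ventures.CertifiedArithmetic.LowPrec.SR
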